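import Mathlib
import Literature.NumberTheory.LFunctions.Zhang2022.TypedSection15B
import Literature.NumberTheory.LFunctions.Zhang2022.Section15BCalM1Analytic
import Literature.NumberTheory.Sieve.DivisorBound
import HarnessLib

/-!
# Zhang (2022) §15 p. 84, display u030: the Euler product of `Σ_n λ̃₁(n,d)ξ₁(n;d,l)n^{−s}` — PROVED

Topic `Literature/NumberTheory/LFunctions/Zhang2022` (Landau–Siegel audit tree; verdict-neutral).
Companion to `TypedSection15B.lean` (the typed §15 part B of Y. Zhang, *Discrete mean estimates and the
Landau–Siegel zero*, arXiv:2211.02515v1 (2022) — an unrefereed manuscript under adjudication), which STATES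
the display of p. 84, tex L4191 (DAG `Z22:§15.u030`):

> If `σ > 1`, then `Σ_n λ̃₁(n,d)ξ₁(n;d,l)/nˢ = ∏_q (1 + λ̃₁(q,d) Σ_r ξ₁(qʳ;d,l)/q^{rs})`

as `Typed.Section15B.Step15_u030 c'`. This file PROVES it (theorems only, no new definitions, no facts),
following the manuscript's own one-line argument ("since `ξ₁(n;d,l)` is multiplicative in `n` and
`λ̃₁(qʳ,d) = λ̃₁(q,d)`", p. 84) with the absolute convergence that the Euler-product theorem needs made
explicit:

* §1 majorants: `|λ₁(q)| ≤ 5` at primes, hence `|λ̃₁(n,d)| ≤ 5^{ω(n)}`; `|ξ₁(n;d,l)| ≤ (4Z₂)^{ω(n)}τ(n)³`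
  from the prime-power bound `|ξ₁(qʳ;d,l)| ≤ 4Z₂(r+1)³` (`Section15B.norm_xi1_prime_pow_le`,
  `Z₂ = Σ_k (k+1)²2^{−k}`) and the multiplicativity of `ξ₁` (`Section15B.inline15_xi1Mult_holds`); with
  `A^{ω(n)} ≤ τ(n)^{log₂ A}` and the divisor bound `τ(n) ≪_ε n^ε` (`Sieve.exists_card_divisors_le_mul_rpow`)
  the Dirichlet series converges absolutely for `σ > 1` (`lseriesSummable_lamTilde1_mul_xi1`);
* §2 the Euler product (`Mathlib`'s `EulerProduct.eulerProduct_hasProd` for the multiplicative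
  `n ↦ λ̃₁(n,d)ξ₁(n;d,l)n^{−s}`) and the local factor `Σ_e λ̃₁(qᵉ,d)ξ₁(qᵉ;d,l)q^{−es} =
  1 + λ̃₁(q,d)Σ_{r≥1}ξ₁(qʳ;d,l)q^{−rs}` (`Section15B.inline15_lamTildePow_holds`), whence
  **`Typed.Section15B.step15_u030_holds : Step15_u030 c'`** — for EVERY `D`, `χ`, `d, l ≥ 1` (no largeness,
  no hypothesis (A)), exactly as typed.

The architecture mirrors the §16 twin `TypedSection16ACalM2.lean` (`hasProd_lamTilde2_xi2`,
`tsum_termG_prime_pow`), with `κ̃₁/ξ₁/λ̃₁` for `κ̃₂/ξ₂/λ̃₂`.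

WHAT THIS IS NOT: a proof of the bound clause of u034/u035 or of anything about Theorems 1–2 /
Landau–Siegel zeros; `Step15_u034` (the identity `ℳ₁ = ℳ₁-series` on `σ > 1`) follows from this file's
theorem by the separate edge `step15_u034_of` (cell seat d01).

## References

* Y. Zhang, arXiv:2211.02515v1 (2022), §15 p. 84 (tex L4191). [cite: Zhang2022LandauSiegel, §15 p. 84]
* G. H. Hardy, E. M. Wright, *An Introduction to the Theory of Numbers*, Thm 315 (divisor bound). [folklore]
-/

open Complex Real Filter Topology
open Literature.NumberTheory.LFunctions.Zhang2022
open Literature.NumberTheory.LFunctions.Zhang2022.Typed.Section15A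
open Literature.NumberTheory.LFunctions.Zhang2022.Typed.Section15B

namespace Literature.NumberTheory.LFunctions.Zhang2022.Typed.Section15BEuler

/-! ## §0. Folklore on `ω`, `τ`, `φ` -/

section Folklore

/-- `2^{ω(n)} ≤ τ(n)` (`n ≥ 1`): `τ(n) = ∏_{p∣n}(v_p(n)+1)` with every factor `≥ 2`. [folklore] -/
private theorem two_pow_card_primeFactors_le_card_divisors {n : ℕ} (hn : n ≠ 0) :
    2 ^ n.primeFactors.card ≤ n.divisors.card := by
  rw [Nat.card_divisors hn]
  refine Finset.pow_card_le_prod _ _ _ fun p hp => ?_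
  have : 0 < n.factorization p := Nat.Prime.factorization_pos_of_dvd (Nat.prime_of_mem_primeFactors hp)
    hn (Nat.dvd_of_mem_primeFactors hp)
  omega

/-- `1 ≤ τ(n)` for `n ≥ 1`. [folklore] -/
private theorem one_le_card_divisors {n : ℕ} (hn : n ≠ 0) : 1 ≤ n.divisors.card :=
  Finset.card_pos.mpr ⟨1, Nat.one_mem_divisors.mpr hn⟩

/-- **`A^{ω(n)} ≤ τ(n)^{log₂ A}`** for `A ≥ 1`, `n ≥ 1` (`A^{ω} = (2^{ω})^{log₂ A}` and `2^{ω(n)} ≤ τ(n)`).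
[folklore] -/
private theorem pow_card_primeFactors_le_rpow_card_divisors {A : ℝ} (hA : 1 ≤ A) {n : ℕ} (hn : n ≠ 0) :
    A ^ n.primeFactors.card ≤ (n.divisors.card : ℝ) ^ Real.logb 2 A := by
  have hA0 : 0 < A := one_pos.trans_le hA
  have ht : 0 ≤ Real.logb 2 A := Real.logb_nonneg one_lt_two hA
  have h2 : (2 : ℝ) ^ (n.primeFactors.card : ℝ) ≤ (n.divisors.card : ℝ) := by
    rw [Real.rpow_natCast]
    exact_mod_cast two_pow_card_primeFactors_le_card_divisors hn
  have hA2 : A = (2 : ℝ) ^ Real.logb 2 A := (Real.rpow_logb two_pos (by norm_num) hA0).symm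
  calc A ^ n.primeFactors.card = ((2 : ℝ) ^ Real.logb 2 A) ^ (n.primeFactors.card : ℝ) := by
        rw [Real.rpow_natCast, ← hA2]
    _ = ((2 : ℝ) ^ (n.primeFactors.card : ℝ)) ^ Real.logb 2 A := by
        rw [← Real.rpow_mul zero_le_two, mul_comm, Real.rpow_mul zero_le_two]
    _ ≤ (n.divisors.card : ℝ) ^ Real.logb 2 A :=
        Real.rpow_le_rpow (by positivity) h2 ht

end Folklore

/-! ## §1. Majorants for `λ̃₁(n,d)` and `ξ₁(n;d,l)` -/

section Majorants

variable (c' : ℝ) {D : ℕ} (χ : DirichletCharacter ℂ D)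

/-- `‖q^{−w}‖ = q⁻¹` when `Re w = 1`. [folklore] -/
private theorem norm_natCast_cpow_neg_of_re {q : ℕ} (hq : 0 < q) {w : ℂ} (hw : w.re = 1) :
    ‖(q : ℂ) ^ (-w)‖ = (q : ℝ)⁻¹ := by
  rw [Complex.norm_natCast_cpow_of_pos hq, Complex.neg_re, hw, Real.rpow_neg_one]

/-- **`|λ₁(q)| ≤ 5`** at a prime `q` (`λ₁(q) = λ₁(q,1) = (1−χ(q)q^{−1−β₁})(1−χ(q)q^{−1−β₂})/(1−χ(q)q^{−1})`,
`Re βⱼ = 0`: numerator factors `≤ 3/2`, denominator `≥ 1/2`). [cite: Zhang2022LandauSiegel, §15 (15.10) p. 82] -/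
theorem norm_lam1_prime_le (q : ℕ) (hq : q.Prime) : ‖lam1 c' χ q 1‖ ≤ 5 := by
  unfold lam1
  rw [hq.primeFactors, Finset.prod_singleton]
  have hq0 : 0 < q := hq.pos
  have hq2 : (2 : ℝ) ≤ q := by exact_mod_cast hq.two_le
  have hqinv : (q : ℝ)⁻¹ ≤ 1 / 2 := by
    rw [inv_eq_one_div]; exact one_div_le_one_div_of_le two_pos hq2
  have hχ : ‖χ (q : ZMod D)‖ ≤ 1 := DirichletCharacter.norm_le_one χ _
  have hb1 : (Skeleton.beta1 c' D).re = 0 := by rw [beta1_eq_b1_mul_I]; simp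
  have hb2 : (Skeleton.beta2 c' D).re = 0 := by rw [beta2_eq_b2_mul_I]; simp
  have hre1 : ((1 : ℂ) + Skeleton.beta1 c' D).re = 1 := by simp [hb1]
  have hre2 : ((1 : ℂ) + Skeleton.beta2 c' D).re = 1 := by simp [hb2]
  have hre0 : (1 : ℂ).re = 1 := rfl
  have hn1 : ‖(q : ℂ) ^ (-((1 : ℂ) + Skeleton.beta1 c' D))‖ = (q : ℝ)⁻¹ :=
    norm_natCast_cpow_neg_of_re hq0 hre1
  have hn2 : ‖(q : ℂ) ^ (-((1 : ℂ) + Skeleton.beta2 c' D))‖ = (q : ℝ)⁻¹ :=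
    norm_natCast_cpow_neg_of_re hq0 hre2
  have hn0 : ‖(q : ℂ) ^ (-(1 : ℂ))‖ = (q : ℝ)⁻¹ := norm_natCast_cpow_neg_of_re hq0 hre0
  -- the three products `χ(q) q^{-w}` have norm `≤ 1/2`
  have hA : ‖χ (q : ZMod D) * (q : ℂ) ^ (-((1 : ℂ) + Skeleton.beta1 c' D))‖ ≤ 1 / 2 := by
    rw [norm_mul, hn1]
    calc ‖χ (q : ZMod D)‖ * (q : ℝ)⁻¹ ≤ 1 * (1 / 2) :=
          mul_le_mul hχ hqinv (by positivity) zero_le_one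
      _ = 1 / 2 := one_mul _
  have hB : ‖χ (q : ZMod D) * (q : ℂ) ^ (-((1 : ℂ) + Skeleton.beta2 c' D))‖ ≤ 1 / 2 := by
    rw [norm_mul, hn2]
    calc ‖χ (q : ZMod D)‖ * (q : ℝ)⁻¹ ≤ 1 * (1 / 2) :=
          mul_le_mul hχ hqinv (by positivity) zero_le_one
      _ = 1 / 2 := one_mul _
  have hC : ‖χ (q : ZMod D) * (q : ℂ) ^ (-(1 : ℂ))‖ ≤ 1 / 2 := by
    rw [norm_mul, hn0]
    calc ‖χ (q : ZMod D)‖ * (q : ℝ)⁻¹ ≤ 1 * (1 / 2) :=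
          mul_le_mul hχ hqinv (by positivity) zero_le_one
      _ = 1 / 2 := one_mul _
  -- numerator factors `≤ 3/2`, denominator `≥ 1/2`
  have hN1 : ‖1 - χ (q : ZMod D) * (q : ℂ) ^ (-((1 : ℂ) + Skeleton.beta1 c' D))‖ ≤ 3 / 2 :=
    calc _ ≤ ‖(1 : ℂ)‖ + ‖χ (q : ZMod D) * (q : ℂ) ^ (-((1 : ℂ) + Skeleton.beta1 c' D))‖ := norm_sub_le _ _
      _ ≤ 1 + 1 / 2 := by rw [norm_one]; linarith
      _ = 3 / 2 := by norm_num
  have hN2 : ‖1 - χ (q : ZMod D) * (q : ℂ) ^ (-((1 : ℂ) + Skeleton.beta2 c' D))‖ ≤ 3 / 2 :=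
    calc _ ≤ ‖(1 : ℂ)‖ + ‖χ (q : ZMod D) * (q : ℂ) ^ (-((1 : ℂ) + Skeleton.beta2 c' D))‖ := norm_sub_le _ _
      _ ≤ 1 + 1 / 2 := by rw [norm_one]; linarith
      _ = 3 / 2 := by norm_num
  have hDen : 1 / 2 ≤ ‖1 - χ (q : ZMod D) * (q : ℂ) ^ (-(1 : ℂ))‖ :=
    calc (1 : ℝ) / 2 = 1 - 1 / 2 := by norm_num
      _ ≤ ‖(1 : ℂ)‖ - ‖χ (q : ZMod D) * (q : ℂ) ^ (-(1 : ℂ))‖ := by rw [norm_one]; linarith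
      _ ≤ ‖1 - χ (q : ZMod D) * (q : ℂ) ^ (-(1 : ℂ))‖ := norm_sub_norm_le _ _
  have hDen0 : 0 < ‖1 - χ (q : ZMod D) * (q : ℂ) ^ (-(1 : ℂ))‖ := by linarith
  rw [norm_div, norm_mul, div_le_iff₀ hDen0]
  calc ‖1 - χ (q : ZMod D) * (q : ℂ) ^ (-((1 : ℂ) + Skeleton.beta1 c' D))‖ *
        ‖1 - χ (q : ZMod D) * (q : ℂ) ^ (-((1 : ℂ) + Skeleton.beta2 c' D))‖
      ≤ (3 / 2) * (3 / 2) := mul_le_mul hN1 hN2 (norm_nonneg _) (by norm_num)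
    _ ≤ 5 * (1 / 2) := by norm_num
    _ ≤ 5 * ‖1 - χ (q : ZMod D) * (q : ℂ) ^ (-(1 : ℂ))‖ := by gcongr

/-- `λ̃₁(1,d) = 1`. [cite: Zhang2022LandauSiegel, §15 p. 83] -/
theorem lamTilde1_one (d : ℕ) : lamTilde1 c' χ 1 d = 1 := by
  unfold lamTilde1; simp

/-- `λ̃₁(mn,d) = λ̃₁(m,d)λ̃₁(n,d)` for coprime `m, n` (disjoint prime factors). [cite: Zhang2022LandauSiegel, §15 p. 83] -/
theorem lamTilde1_mul_of_coprime {m n : ℕ} (hmn : Nat.Coprime m n) (d : ℕ) :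
    lamTilde1 c' χ (m * n) d = lamTilde1 c' χ m d * lamTilde1 c' χ n d := by
  unfold lamTilde1
  rw [Nat.Coprime.primeFactors_mul hmn, Finset.filter_union,
    Finset.prod_union (Finset.disjoint_filter_filter hmn.disjoint_primeFactors)]

/-- `λ̃₁(qᵉ,d) = λ̃₁(q,d)` (`q` prime, `e ≥ 1`) — p. 84 "Note that `λ̃₁(qʳ,d) = λ̃₁(q,d)`"
(`Section15B.inline15_lamTildePow_holds`). [cite: Zhang2022LandauSiegel, §15 p. 84] -/
theorem lamTilde1_prime_pow {q e : ℕ} (hq : q.Prime) (he : e ≠ 0) (d : ℕ) :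
    lamTilde1 c' χ (q ^ e) d = lamTilde1 c' χ q d :=
  inline15_lamTildePow_holds c' D χ q d e hq (Nat.one_le_iff_ne_zero.mpr he)

/-- **`|λ̃₁(n,d)| ≤ 5^{ω(n)}`** (a product of `|λ₁(q)| ≤ 5` over some of the primes of `n`).
[cite: Zhang2022LandauSiegel, §15 p. 83] -/
theorem norm_lamTilde1_le_five_pow (n d : ℕ) :
    ‖lamTilde1 c' χ n d‖ ≤ 5 ^ n.primeFactors.card := by
  unfold lamTilde1
  rw [norm_prod]
  calc ∏ q ∈ n.primeFactors.filter (fun q => Nat.Coprime q d), ‖lam1 c' χ q 1‖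
      ≤ ∏ _q ∈ n.primeFactors.filter (fun q => Nat.Coprime q d), (5 : ℝ) :=
        Finset.prod_le_prod (fun _ _ => norm_nonneg _) fun q hq =>
          norm_lam1_prime_le c' χ q (Nat.prime_of_mem_primeFactors (Finset.mem_filter.mp hq).1)
    _ = 5 ^ (n.primeFactors.filter (fun q => Nat.Coprime q d)).card := Finset.prod_const 5
    _ ≤ 5 ^ n.primeFactors.card :=
        pow_le_pow_right₀ (by norm_num) (Finset.card_filter_le _ _)

/-- `ξ₁(0;d,l) = 0` (junk value: `0` has no divisors). [folklore] -/
private theorem xi1_zero (d l : ℕ) : xi1 c' χ 0 d l = 0 := by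
  unfold Section15B.xi1; simp

/-- `ξ₁(1;d,l) = 1` (`d, l ≥ 1`; `Section15B.inline15_xi1Mult_holds`). [cite: Zhang2022LandauSiegel, §15 (15.13) p. 83] -/
theorem xi1_one {d l : ℕ} (hd : 1 ≤ d) (hl : 1 ≤ l) : xi1 c' χ 1 d l = 1 :=
  (inline15_xi1Mult_holds c' D χ d l hd hl).1

/-- `ξ₁(mn;d,l) = ξ₁(m;d,l)ξ₁(n;d,l)` for coprime `m, n` (`d, l ≥ 1`; p. 83 "`ξ₁(n;d,l)` is a multiplicative
function of `n`", `Section15B.inline15_xi1Mult_holds`). [cite: Zhang2022LandauSiegel, §15 p. 83] -/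
theorem xi1_mul_of_coprime {d l : ℕ} (hd : 1 ≤ d) (hl : 1 ≤ l) {m n : ℕ} (hmn : Nat.Coprime m n) :
    xi1 c' χ (m * n) d l = xi1 c' χ m d l * xi1 c' χ n d l :=
  (inline15_xi1Mult_holds c' D χ d l hd hl).2 m n hmn

/-- **`|ξ₁(n;d,l)| ≤ (4Z₂)^{ω(n)} τ(n)³`** (`n, d, l ≥ 1`, `Z₂ = Σ_k (k+1)²2^{−k}`): multiplicativity of `ξ₁`
and the prime-power bound `|ξ₁(qʳ;d,l)| ≤ 4Z₂(r+1)³` (`Section15B.norm_xi1_prime_pow_le`).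
[cite: Zhang2022LandauSiegel, §15 (15.13) p. 83] -/
theorem norm_xi1_le {d l : ℕ} (hd : 1 ≤ d) (hl : 1 ≤ l) {n : ℕ} (hn : n ≠ 0) :
    ‖xi1 c' χ n d l‖ ≤
      (4 * ∑' k : ℕ, ((k : ℝ) + 1) ^ 2 * (1 / 2 : ℝ) ^ k) ^ n.primeFactors.card *
        (n.divisors.card : ℝ) ^ 3 := by
  set Z₂ : ℝ := ∑' k : ℕ, ((k : ℝ) + 1) ^ 2 * (1 / 2 : ℝ) ^ k with hZ₂
  have hZ₂0 : 0 ≤ Z₂ := tsum_nonneg fun k => by positivity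
  have h4Z : 0 ≤ 4 * Z₂ := by positivity
  induction n using Nat.recOnPosPrimePosCoprime with
  | prime_pow p k hp hk =>
    rw [Nat.primeFactors_prime_pow hk.ne' hp, Finset.card_singleton, pow_one,
      Nat.divisors_prime_pow hp, Finset.card_map, Finset.card_range]
    push_cast
    exact norm_xi1_prime_pow_le c' χ hp d l k
  | zero => exact absurd rfl hn
  | one =>
    rw [xi1_one c' χ hd hl, Nat.primeFactors_one, Finset.card_empty, pow_zero, Nat.divisors_one,
      Finset.card_singleton]
    simp
  | coprime a b ha hb hab iha ihb =>
    have ha0 : a ≠ 0 := by omega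
    have hb0 : b ≠ 0 := by omega
    rw [xi1_mul_of_coprime c' χ hd hl hab, norm_mul, Nat.Coprime.primeFactors_mul hab,
      Finset.card_union_of_disjoint hab.disjoint_primeFactors,
      Nat.Coprime.card_divisors_mul hab, Nat.cast_mul]
    calc ‖xi1 c' χ a d l‖ * ‖xi1 c' χ b d l‖
        ≤ ((4 * Z₂) ^ a.primeFactors.card * (a.divisors.card : ℝ) ^ 3) *
            ((4 * Z₂) ^ b.primeFactors.card * (b.divisors.card : ℝ) ^ 3) :=
          mul_le_mul (iha ha0) (ihb hb0) (norm_nonneg _) (by positivity)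
      _ = (4 * Z₂) ^ (a.primeFactors.card + b.primeFactors.card) *
            ((a.divisors.card : ℝ) * (b.divisors.card : ℝ)) ^ 3 := by ring

/-- **`|λ̃₁(n,d)ξ₁(n;d,l)| ≤ (20Z₂+1)^{ω(n)} τ(n)³ ≤ τ(n)^{3 + log₂(20Z₂+1)}`** (`n, d, l ≥ 1`).
[cite: Zhang2022LandauSiegel, §15 p. 84 (u030)] -/
theorem norm_lamTilde1_mul_xi1_le {d l : ℕ} (hd : 1 ≤ d) (hl : 1 ≤ l) {n : ℕ} (hn : n ≠ 0) :
    ‖lamTilde1 c' χ n d * xi1 c' χ n d l‖ ≤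
      (n.divisors.card : ℝ) ^
        ((3 : ℝ) + Real.logb 2 (20 * (∑' k : ℕ, ((k : ℝ) + 1) ^ 2 * (1 / 2 : ℝ) ^ k) + 1)) := by
  set Z₂ : ℝ := ∑' k : ℕ, ((k : ℝ) + 1) ^ 2 * (1 / 2 : ℝ) ^ k with hZ₂
  have hZ₂0 : 0 ≤ Z₂ := tsum_nonneg fun k => by positivity
  set A : ℝ := 20 * Z₂ + 1 with hA
  have hA1 : 1 ≤ A := by rw [hA]; linarith [mul_nonneg (show (0:ℝ) ≤ 20 by norm_num) hZ₂0]
  have hτ1 : (1 : ℝ) ≤ n.divisors.card := by exact_mod_cast one_le_card_divisors hn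
  have hτ0 : (0 : ℝ) < n.divisors.card := one_pos.trans_le hτ1
  -- `(5·4Z₂)^{ω} ≤ A^{ω} ≤ τ^{log₂ A}`
  have hpow : (5 : ℝ) ^ n.primeFactors.card * (4 * Z₂) ^ n.primeFactors.card ≤ A ^ n.primeFactors.card := by
    rw [← mul_pow]
    exact pow_le_pow_left₀ (by positivity) (by rw [hA]; linarith) _
  have h1 : ‖lamTilde1 c' χ n d * xi1 c' χ n d l‖ ≤ A ^ n.primeFactors.card * (n.divisors.card : ℝ) ^ 3 := by
    rw [norm_mul]
    calc ‖lamTilde1 c' χ n d‖ * ‖xi1 c' χ n d l‖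
        ≤ (5 : ℝ) ^ n.primeFactors.card * ((4 * Z₂) ^ n.primeFactors.card * (n.divisors.card : ℝ) ^ 3) :=
          mul_le_mul (norm_lamTilde1_le_five_pow c' χ n d) (norm_xi1_le c' χ hd hl hn) (norm_nonneg _)
            (by positivity)
      _ = ((5 : ℝ) ^ n.primeFactors.card * (4 * Z₂) ^ n.primeFactors.card) * (n.divisors.card : ℝ) ^ 3 := by
          ring
      _ ≤ A ^ n.primeFactors.card * (n.divisors.card : ℝ) ^ 3 := by gcongr
  have h2 : A ^ n.primeFactors.card ≤ (n.divisors.card : ℝ) ^ Real.logb 2 A :=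
    pow_card_primeFactors_le_rpow_card_divisors hA1 hn
  calc ‖lamTilde1 c' χ n d * xi1 c' χ n d l‖ ≤ A ^ n.primeFactors.card * (n.divisors.card : ℝ) ^ 3 := h1
    _ ≤ (n.divisors.card : ℝ) ^ Real.logb 2 A * (n.divisors.card : ℝ) ^ 3 := by gcongr
    _ = (n.divisors.card : ℝ) ^ ((3 : ℝ) + Real.logb 2 A) := by
        rw [Real.rpow_add hτ0, mul_comm]
        congr 1
        exact_mod_cast (Real.rpow_natCast (n.divisors.card : ℝ) 3).symm

/-- **Absolute convergence of `Σ_n λ̃₁(n,d)ξ₁(n;d,l)n^{−s}` for `σ > 1`** (`d, l ≥ 1`): with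
`t = 3 + log₂(20Z₂+1)`, `δ = (σ−1)/2` and the divisor bound `τ(n) ≤ C n^{δ/t}` (Hardy–Wright Thm 315,
`Sieve.exists_card_divisors_le_mul_rpow`) the terms are `≤ Cᵗ n^{δ−σ}`, `δ − σ < −1`.
[cite: Zhang2022LandauSiegel, §15 p. 84 (u030)] -/
theorem lseriesSummable_lamTilde1_mul_xi1 {d l : ℕ} (hd : 1 ≤ d) (hl : 1 ≤ l) {s : ℂ} (hs : 1 < s.re) :
    LSeriesSummable (fun n => lamTilde1 c' χ n d * xi1 c' χ n d l) s := by
  set Z₂ : ℝ := ∑' k : ℕ, ((k : ℝ) + 1) ^ 2 * (1 / 2 : ℝ) ^ k with hZ₂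
  have hZ₂0 : 0 ≤ Z₂ := tsum_nonneg fun k => by positivity
  set t : ℝ := (3 : ℝ) + Real.logb 2 (20 * Z₂ + 1) with ht
  have hlogb : 0 ≤ Real.logb 2 (20 * Z₂ + 1) :=
    Real.logb_nonneg one_lt_two (by linarith [mul_nonneg (show (0:ℝ) ≤ 20 by norm_num) hZ₂0])
  have ht0 : 0 < t := by rw [ht]; linarith
  set δ : ℝ := (s.re - 1) / 2 with hδ
  have hδ0 : 0 < δ := by rw [hδ]; linarith
  obtain ⟨C, hC1, hC⟩ := Literature.NumberTheory.Sieve.exists_card_divisors_le_mul_rpow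
    (show 0 < δ / t by positivity)
  have hC0 : 0 ≤ C := zero_le_one.trans hC1
  have hexp : δ - s.re < -1 := by rw [hδ]; linarith
  have hmaj : Summable fun n : ℕ => C ^ t * (n : ℝ) ^ (δ - s.re) :=
    (Real.summable_nat_rpow.mpr hexp).mul_left _
  refine Summable.of_norm_bounded hmaj fun n => ?_
  rcases eq_or_ne n 0 with rfl | hn
  · simp only [LSeries.term_zero, norm_zero, Nat.cast_zero]
    exact mul_nonneg (Real.rpow_nonneg hC0 t) (Real.rpow_nonneg le_rfl _)
  have hnR : (0 : ℝ) < n := by exact_mod_cast Nat.pos_of_ne_zero hn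
  have hτ0 : (0 : ℝ) ≤ n.divisors.card := Nat.cast_nonneg _
  rw [LSeries.term_of_ne_zero hn, norm_div, Complex.norm_natCast_cpow_of_pos (Nat.pos_of_ne_zero hn),
    div_le_iff₀ (Real.rpow_pos_of_pos hnR _)]
  have hτ : (n.divisors.card : ℝ) ≤ C * (n : ℝ) ^ (δ / t) := hC n hn
  have hτt : (n.divisors.card : ℝ) ^ t ≤ (C * (n : ℝ) ^ (δ / t)) ^ t :=
    Real.rpow_le_rpow hτ0 hτ ht0.le
  calc ‖lamTilde1 c' χ n d * xi1 c' χ n d l‖ ≤ (n.divisors.card : ℝ) ^ t :=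
        norm_lamTilde1_mul_xi1_le c' χ hd hl hn
    _ ≤ (C * (n : ℝ) ^ (δ / t)) ^ t := hτt
    _ = C ^ t * (n : ℝ) ^ δ := by
        rw [Real.mul_rpow hC0 (Real.rpow_nonneg hnR.le _), ← Real.rpow_mul hnR.le,
          div_mul_cancel₀ δ ht0.ne']
    _ = C ^ t * (n : ℝ) ^ (δ - s.re) * (n : ℝ) ^ s.re := by
        rw [mul_assoc, ← Real.rpow_add hnR]; congr 2; ring

end Majorants

/-! ## §2. The Euler product (display u030) -/

section Euler

open scoped LSeries.notation
open LSeries (term)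

variable (c' : ℝ) {D : ℕ} (χ : DirichletCharacter ℂ D)

/-- `(q^e)^s = (q^s)^e` for naturals `q, e` and complex `s`. [folklore] -/
private theorem natCast_pow_cpow (q e : ℕ) (s : ℂ) : ((q ^ e : ℕ) : ℂ) ^ s = ((q : ℂ) ^ s) ^ e := by
  induction e with
  | zero => simp
  | succ e ih => rw [pow_succ, Nat.cast_mul, Complex.natCast_mul_natCast_cpow, ih, pow_succ]

/-- The `L`-series term of `λ̃₁ξ₁` at `1` is `1` (`d, l ≥ 1`). [cite: Zhang2022LandauSiegel, §15 p. 84 (u030)] -/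
private theorem termF_one {d l : ℕ} (hd : 1 ≤ d) (hl : 1 ≤ l) (s : ℂ) :
    term (fun n => lamTilde1 c' χ n d * xi1 c' χ n d l) s 1 = 1 := by
  rw [LSeries.term_of_ne_zero one_ne_zero, lamTilde1_one, xi1_one c' χ hd hl, Nat.cast_one,
    Complex.one_cpow]
  norm_num

/-- The `L`-series terms of `λ̃₁ξ₁` are multiplicative on coprime arguments (`d, l ≥ 1`).
[cite: Zhang2022LandauSiegel, §15 p. 84 (u030)] -/
private theorem termF_mul_of_coprime {d l : ℕ} (hd : 1 ≤ d) (hl : 1 ≤ l) (s : ℂ) {m n : ℕ}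
    (hmn : Nat.Coprime m n) :
    term (fun k => lamTilde1 c' χ k d * xi1 c' χ k d l) s (m * n) =
      term (fun k => lamTilde1 c' χ k d * xi1 c' χ k d l) s m *
        term (fun k => lamTilde1 c' χ k d * xi1 c' χ k d l) s n := by
  rcases eq_or_ne m 0 with rfl | hm
  · simp
  rcases eq_or_ne n 0 with rfl | hn
  · simp
  rw [LSeries.term_of_ne_zero (mul_ne_zero hm hn), LSeries.term_of_ne_zero hm,
    LSeries.term_of_ne_zero hn, lamTilde1_mul_of_coprime c' χ hmn, xi1_mul_of_coprime c' χ hd hl hmn,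
    Nat.cast_mul, Complex.natCast_mul_natCast_cpow, div_mul_div_comm]
  ring

/-- **Euler product of `Σ_n λ̃₁(n,d)ξ₁(n;d,l)n^{−s}`** (`σ > 1`, `d, l ≥ 1`):
`HasProd (q ↦ Σ_e λ̃₁(qᵉ,d)ξ₁(qᵉ;d,l)q^{−es}) (Σ_n λ̃₁ξ₁n^{−s})`. [cite: Zhang2022LandauSiegel, §15 p. 84 (u030)] -/
theorem hasProd_lamTilde1_xi1 {d l : ℕ} (hd : 1 ≤ d) (hl : 1 ≤ l) {s : ℂ} (hs : 1 < s.re) :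
    HasProd (fun q : Nat.Primes => ∑' e : ℕ, term (fun n => lamTilde1 c' χ n d * xi1 c' χ n d l) s (q ^ e))
      (∑' n : ℕ, term (fun n => lamTilde1 c' χ n d * xi1 c' χ n d l) s n) :=
  EulerProduct.eulerProduct_hasProd (termF_one c' χ hd hl s)
    (fun hmn => termF_mul_of_coprime c' χ hd hl s hmn)
    (lseriesSummable_lamTilde1_mul_xi1 c' χ hd hl hs).norm (LSeries.term_zero _ _)

/-- **The local factor**: `Σ_e λ̃₁(qᵉ,d)ξ₁(qᵉ;d,l)q^{−es} = 1 + λ̃₁(q,d)·Σ_{r≥1} ξ₁(qʳ;d,l)q^{−rs}`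
(`λ̃₁(qʳ,d) = λ̃₁(q,d)` for `r ≥ 1`; the right side is `1 + λ̃₁(q,d)·xi1LocalSeries`).
[cite: Zhang2022LandauSiegel, §15 p. 84 (u030)] -/
theorem tsum_termF_prime_pow {d l : ℕ} (hd : 1 ≤ d) (hl : 1 ≤ l) {s : ℂ} (hs : 1 < s.re) {q : ℕ}
    (hq : q.Prime) :
    ∑' e : ℕ, term (fun n => lamTilde1 c' χ n d * xi1 c' χ n d l) s (q ^ e) =
      1 + lamTilde1 c' χ q d * xi1LocalSeries c' χ q d l s := by
  set G : ℕ → ℂ := fun e => term (fun n => lamTilde1 c' χ n d * xi1 c' χ n d l) s (q ^ e) with hG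
  have hGsum : Summable G :=
    (lseriesSummable_lamTilde1_mul_xi1 c' χ hd hl hs).comp_injective (Nat.pow_right_injective hq.two_le)
  -- split `G e = a e + λ̃₁(q,d) b e`
  set a : ℕ → ℂ := fun e => if e = 0 then 1 else 0 with ha
  set b : ℕ → ℂ := fun e => if e = 0 then 0 else xi1 c' χ (q ^ e) d l / (q : ℂ) ^ ((e : ℂ) * s) with hb
  have hGe : ∀ e, G e = a e + lamTilde1 c' χ q d * b e := by
    intro e
    rcases eq_or_ne e 0 with rfl | he
    · simp only [hG, ha, hb, if_true, pow_zero, mul_zero, add_zero]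
      exact termF_one c' χ hd hl s
    · simp only [hG, ha, hb, if_neg he, zero_add]
      rw [LSeries.term_of_ne_zero (pow_ne_zero e hq.ne_zero), lamTilde1_prime_pow c' χ hq he,
        natCast_pow_cpow, Complex.cpow_nat_mul]
      ring
  have hasum : HasSum a 1 := hasSum_ite_eq 0 1
  have hGfun : G = fun e => a e + lamTilde1 c' χ q d * b e := funext hGe
  by_cases hlam : lamTilde1 c' χ q d = 0
  · -- then `G = a` and both sides are `1`
    have hGa : G = a := by
      rw [hGfun]; funext e; rw [hlam, zero_mul, add_zero]
    rw [hGa, hasum.tsum_eq, hlam, zero_mul, add_zero]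
  · have hbsum : Summable b := by
      have hb' : b = fun e => (lamTilde1 c' χ q d)⁻¹ * (G e - a e) := by
        funext e; rw [hGe e]; field_simp; ring
      rw [hb']
      exact (hGsum.sub hasum.summable).mul_left _
    rw [hGfun, hasum.summable.tsum_add (hbsum.mul_left _), hasum.tsum_eq, tsum_mul_left]
    simp only [hb, xi1LocalSeries]

end Euler

end Literature.NumberTheory.LFunctions.Zhang2022.Typed.Section15BEuler

/-! ## §3. Display u030 as typed: `Typed.Section15B.step15_u030_holds` -/

namespace Literature.NumberTheory.LFunctions.Zhang2022.Typed.Section15B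

open Literature.NumberTheory.LFunctions.Zhang2022.Typed.Section15BEuler

/-- **§15 p. 84 display u030 (tex L4191), PROVED: for `σ > 1` (and every `D`, `χ`, `d, l ≥ 1`)
`Σ_n λ̃₁(n,d)ξ₁(n;d,l)n^{−s} = ∏_q (1 + λ̃₁(q,d)Σ_{r≥1} ξ₁(qʳ;d,l)q^{−rs})`.** DAG `Z22:§15.u030` = discharged.
[cite: Zhang2022LandauSiegel, §15 p. 84] -/
theorem step15_u030_holds (c' : ℝ) : Step15_u030 c' := by
  intro D χ d l hd hl s hs
  have hP := hasProd_lamTilde1_xi1 c' χ hd hl hs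
  have hloc : (fun q : Nat.Primes => ∑' e : ℕ,
      LSeries.term (fun n => lamTilde1 c' χ n d * xi1 c' χ n d l) s ((q : ℕ) ^ e)) =
      fun q : Nat.Primes => 1 + lamTilde1 c' χ (q : ℕ) d * xi1LocalSeries c' χ (q : ℕ) d l s :=
    funext fun q => tsum_termF_prime_pow c' χ hd hl hs q.prop
  rw [hloc] at hP
  rw [hP.tprod_eq]
  refine tsum_congr fun n => ?_
  rcases eq_or_ne n 0 with rfl | hn
  · rw [LSeries.term_zero, xi1_zero, mul_zero, zero_div]
  · rw [LSeries.term_of_ne_zero hn]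

variable (c' : ℝ) in
/-- `Step15_u030` — `_holds` alias of `step15_u030_holds` above under the fact's exact name, stated under the
prover's own binders as section variables (appended 2026-08-28, D-0026 bookkeeping: the proof term is the
existing theorem of this file; no statement, definition or attribute is edited; no new named fact; the
ledger's debt table listed the fact unproved). [cite: Zhang2022LandauSiegel, §15 p. 84] -/
theorem _root_.Literature.NumberTheory.LFunctions.Zhang2022.Typed.Section15B.Step15_u030_holds :
    _root_.Literature.NumberTheory.LFunctions.Zhang2022.Typed.Section15B.Step15_u030 c' :=
  _root_.Literature.NumberTheory.LFunctions.Zhang2022.Typed.Section15B.step15_u030_holds (c' := c')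

end Literature.NumberTheory.LFunctions.Zhang2022.Typed.Section15B
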